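import Summits.QuantumFields.YangMills.Theorems.BalabanLadderNTMarkovMirrorDefect
import HarnessLib

/-!
# Crux `UVSeamRec` (stmt-QuantumFields-20043) / `NT` (stmt-QuantumFields-19353):
# the chirality-defect response depends only on the OSCILLATION of the one-point function across the support

Markov–mirror series, file 13 (fleet lead prover of crux `UVSeamRec`, unit `ym-spine-20043-p1`, g7).
`…MarkovMirrorDefect.defect_response_le` (g6, p510134) bounds the boundary response of the chirality defect
`|kerE_Q^ζ(Wᴿ) − kerE_Q^ζ(Ṽ) − p'|` by `N · K · 6h` from a per-site one-point law `|kerE_Q^ζ(plane_q x) − p_q| ≤ h`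
with reference values `p_q` and the correction `p' = (∑_q p_q) · ∑_x [v(s·(x+e₀)) − v(s·x)]`.  Two remarks make the
(RBLΔ) supplier sharper and are recorded here as theorems:

* `sum_shift_e0_eq` / `sum_increment_e0_eq_zero`: when the lattice support of `v(s·)` sits inside the cube at depth
  `≥ 2`, the increments `v(s·(x+e₀)) − v(s·x)` sum to ZERO over the cube (a discrete derivative of a compactly
  supported function), so `p' = 0` for EVERY choice of the reference values;
* `defect_response_le_osc`: consequently the reference values may depend on the exterior `ζ` — only the
  OSCILLATION `h` of `x ↦ kerE_Q^ζ(plane_q x)` across the (shifted) support enters: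
  `|kerE_Q^ζ(Wᴿ) − kerE_Q^ζ(Ṽ)| ≤ N · K · 6h`.  An exterior that shifts the one-point function by a
  DEPTH-INDEPENDENT amount (however large — e.g. the continuation of a constant self-dual abelian boundary flux,
  kit jobs j273821/j273822 of this seat) produces NO defect response at all.

Nothing here is a claim about (RBLΔ), NT, the floors or the gap.
-/

set_option autoImplicit false

noncomputable section

open scoped SchwartzMap
open MeasureTheory Filter Topology
open Literature.MathematicalPhysics.QuantumFieldTheory Literature.MathematicalPhysics.QuantumLattice
open Literature.Probability.LatticeModels
open Summit.QuantumFields.YangMills.Cruxes.OSLegsFromFemtoAndGap.DlrCollarTransfer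
open Summit.QuantumFields.YangMills.Cruxes.OSLegsFromFemtoAndGap.DlrCollarTransfer.StubLower (mem_cubeSites_iff)

namespace Summit.QuantumFields.YangMills.Cruxes.NT.MarkovMirror

section DefectOsc

variable (G : Type) [Group G] [TopologicalSpace G] [IsTopologicalGroup G] [CompactSpace G]
  [MeasurableSpace G] [BorelSpace G] (r : LatticeRep G)

/-- Shift invariance of the smearing sum: if the lattice support of `v(s·)` lies in the cube at depth `≥ 2`, then
`∑_{x ∈ Q} v(s·(x + e₀)) = ∑_{x ∈ Q} v(s·x)` (the shifted support is still inside the cube). [folklore] -/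
theorem sum_shift_e0_eq (c : Fin 4 → ℤ) (b : ℕ) (s : ℝ) (v : 𝓢(EuclideanSpace ℝ (Fin 4), ℝ))
    (hsupp : ∀ x : Fin 4 → ℤ, v (s • siteToE x) ≠ 0 → x ∈ cubeSites c b ∧ 2 ≤ depth c b x) :
    ∑ x ∈ cubeSites c b, v (s • siteToE (x + Pi.single 0 1)) = ∑ x ∈ cubeSites c b, v (s • siteToE x) := by
  classical
  refine Finset.sum_bij_ne_zero (fun x _ _ => x + Pi.single 0 1) (fun x _ hne => (hsupp _ hne).1)
    (fun x₁ _ _ x₂ _ _ h => add_right_cancel h) (fun y _ hne => ?_) (fun x _ _ => rfl)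
  -- surjectivity: `y − e₀ ∈ Q` since `v(s·y) ≠ 0` forces depth `≥ 2`
  have hd := window_of_two_le_depth (hsupp y hne).2
  refine ⟨y - Pi.single 0 1, ?_, by rw [sub_add_cancel]; exact hne, sub_add_cancel _ _⟩
  rw [mem_cubeSites_iff]
  intro j
  have := hd j
  have hy := (mem_cubeSites_iff _ _ _).1 (hsupp y hne).1 j
  by_cases hj : j = 0
  · subst hj; simp only [Pi.sub_apply, Pi.single_eq_same]; constructor <;> linarith
  · simp only [Pi.sub_apply, Pi.single_eq_of_ne hj, sub_zero]; exact hy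

/-- The increments of the smearing weights sum to zero over the cube: `∑_{x ∈ Q} [v(s·(x+e₀)) − v(s·x)] = 0`
(discrete derivative of a function whose support sits at depth `≥ 2`). [folklore] -/
theorem sum_increment_e0_eq_zero (c : Fin 4 → ℤ) (b : ℕ) (s : ℝ) (v : 𝓢(EuclideanSpace ℝ (Fin 4), ℝ))
    (hsupp : ∀ x : Fin 4 → ℤ, v (s • siteToE x) ≠ 0 → x ∈ cubeSites c b ∧ 2 ≤ depth c b x) :
    ∑ x ∈ cubeSites c b, (v (s • siteToE (x + Pi.single 0 1)) - v (s • siteToE x)) = 0 := by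
  rw [Finset.sum_sub_distrib, sum_shift_e0_eq c b s v hsupp, sub_self]

/-- The correction term of `defect_response_le` vanishes for EVERY choice of reference values `p_q`:
`∑_x [v(s·(x+e₀)) − v(s·x)] · ∑_q [q electric] p_q = 0`. [folklore] -/
theorem defect_reference_term_eq_zero (c : Fin 4 → ℤ) (b : ℕ) (s : ℝ) (v : 𝓢(EuclideanSpace ℝ (Fin 4), ℝ))
    (hsupp : ∀ x : Fin 4 → ℤ, v (s • siteToE x) ≠ 0 → x ∈ cubeSites c b ∧ 2 ≤ depth c b x)
    (pq : {q : Fin 4 × Fin 4 // q.1 < q.2} → ℝ) :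
    ∑ x ∈ cubeSites c b, (v (s • siteToE (x + Pi.single 0 1)) - v (s • siteToE x)) *
        ∑ q : {q : Fin 4 × Fin 4 // q.1 < q.2}, (if q.1.1 = 0 then pq q else 0) = 0 := by
  rw [← Finset.sum_mul, sum_increment_e0_eq_zero c b s v hsupp, zero_mul]

/-- **Oscillation form of the defect response.**  For a FIXED exterior `ζ`, if the electric one-point functions
`x ↦ kerE_Q^ζ(plane_q x)` stay within `h` of some (ζ-dependent) values `p_q` at every site of the (shifted)
support of `v(s·)` — i.e. their oscillation across the support is `≤ 2h` — the increments are `≤ K` and at most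
`N` sites carry support, then the boundary response of the chirality defect itself is small:
`|kerE_Q^ζ(Wᴿ) − kerE_Q^ζ(Ṽ)| ≤ N · K · 6h`.  A depth-independent shift of the one-point functions, however
large, gives no response (`defect_reference_term_eq_zero`). [folklore] -/
theorem defect_response_le_osc (β : ℝ) (c : Fin 4 → ℤ) (b : ℕ) (s : ℝ) (v : 𝓢(EuclideanSpace ℝ (Fin 4), ℝ))
    (hsupp : ∀ x : Fin 4 → ℤ, v (s • siteToE x) ≠ 0 → x ∈ cubeSites c b ∧ 2 ≤ depth c b x)
    (ζ : LGConfig 4 G) (pq : {q : Fin 4 × Fin 4 // q.1 < q.2} → ℝ) {h K : ℝ} (hh : 0 ≤ h) (hK : 0 ≤ K)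
    (hBL : ∀ q : {q : Fin 4 × Fin 4 // q.1 < q.2}, q.1.1 = 0 → ∀ x ∈ cubeSites c b,
      (v (s • siteToE x) ≠ 0 ∨ v (s • siteToE (x + Pi.single 0 1)) ≠ 0) →
        |kerE G r β c b ζ (plane G r q.1 x) - pq q| ≤ h)
    (hLip : ∀ x : Fin 4 → ℤ, |v (s • siteToE (x + Pi.single 0 1)) - v (s • siteToE x)| ≤ K)
    (N : ℕ) (hN : ((cubeSites c b).filter fun x =>
      v (s • siteToE x) ≠ 0 ∨ v (s • siteToE (x + Pi.single 0 1)) ≠ 0).card ≤ N) :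
    |kerE G r β c b ζ (fun V => ∑ x ∈ cubeSites c b, v (s • siteToE x) *
          ∑ q : {q : Fin 4 × Fin 4 // q.1 < q.2}, plane G r q.1 (if q.1.1 = 0 then x - Pi.single 0 1 else x) V) -
        kerE G r β c b ζ (fun V => ∑ y ∈ cubeSites c b, v (s • siteToE y) * dens G r y V)| ≤ N * (K * (6 * h)) := by
  have h0 := defect_response_le G r β c b s v hsupp ζ pq hh hK hBL hLip N hN
  rwa [defect_reference_term_eq_zero c b s v hsupp pq, sub_zero] at h0

end DefectOsc

end Summit.QuantumFields.YangMills.Cruxes.NT.MarkovMirror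

end
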